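import Summits.SmoothPoincare4.SmoothPoincare4.Theorems.DottedCircleRasmussenDcrGapHelperFriendsCarrierVkPartAFrameTube

/-!
# Helper `helper_friendsCarrier_Vk_partA_partIII_tube` (piece of the registered stub
`helper_friendsCarrier_Vk_partA_partIII`, line `mk_friends`, skeleton v9) for crux `DcrGap`
(item stmt-SmoothPoincare4-16128, route route-SmoothPoincare4-DottedCircleRasmussen)

**The affine tube of an embedded disc of any radius.**  The tree's `exists_discTube_of_frame`
(`…HelperFriendsCarrierVkPartAFrameTube`: for `f` injective on the closed unit disc and a transversal `C^∞`
frame `(m₀, m₁)`, the affine tube `F(x, v) = f x + v₀ m₀ x + v₁ m₁ x` is injective on `B̄(0, 1+δ) × B̄(0, η)`,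
has open image of the open bidisc and a smooth inverse there) rescaled from radius `1` to radius `s > 0`
(precompose with `x ↦ s x`): `F` is injective on `B̄(0, s) × B̄(0, η)`, `F(B(0, s) × B(0, η))` is open, and
`F` has a continuous inverse on it.

* `helper_friendsCarrier_Vk_partA_partIII_tube` — the statement.

No definitions, no named facts, no `sorry`.

## References

* M. W. Hirsch, *Differential Topology*, GTM 33 (1976), Ch. 4 §5 Thm. 5.1 (tubular neighbourhoods). [Hirsch1976]
-/

-- the prescribed namespace `Summit.<P>.<Sub>.…` duplicates `SmoothPoincare4` (P = Sub)
set_option linter.dupNamespace false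
set_option linter.style.longLine false

noncomputable section

open scoped Manifold ContDiff Topology
open Set Function Metric Filter
open Literature.Topology.FourManifolds

namespace Summit.SmoothPoincare4.SmoothPoincare4.Theorems.DcrGap.MkFriends

namespace FriendsCarrierVk

/-- **The affine tube of an embedded disc of radius `s`** (see the module docstring).
[cite: Hirsch1976, Ch. 4 §5 Thm. 5.1] -/
theorem exists_tube_of_radius {f m₀ m₁ : EuclideanSpace ℝ (Fin 2) → EuclideanSpace ℝ (Fin 4)}
    (hf : ContDiff ℝ ∞ f) (hm₀ : ContDiff ℝ ∞ m₀) (hm₁ : ContDiff ℝ ∞ m₁) {s : ℝ} (hs : 0 < s)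
    (hinj : InjOn f (closedBall (0 : EuclideanSpace ℝ (Fin 2)) s))
    (htr : ∀ x ∈ closedBall (0 : EuclideanSpace ℝ (Fin 2)) s, ∀ (e : EuclideanSpace ℝ (Fin 2)) (α β : ℝ),
      fderiv ℝ f x e + α • m₀ x + β • m₁ x = 0 → e = 0 ∧ α = 0 ∧ β = 0) :
    ∃ (η : ℝ) (Finv : EuclideanSpace ℝ (Fin 4) → EuclideanSpace ℝ (Fin 2) × EuclideanSpace ℝ (Fin 2)), 0 < η ∧
      InjOn (fun q : EuclideanSpace ℝ (Fin 2) × EuclideanSpace ℝ (Fin 2) => f q.1 + q.2 0 • m₀ q.1 + q.2 1 • m₁ q.1)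
        (closedBall (0 : EuclideanSpace ℝ (Fin 2)) s ×ˢ closedBall (0 : EuclideanSpace ℝ (Fin 2)) η) ∧
      IsOpen ((fun q : EuclideanSpace ℝ (Fin 2) × EuclideanSpace ℝ (Fin 2) => f q.1 + q.2 0 • m₀ q.1 + q.2 1 • m₁ q.1) ''
        (ball (0 : EuclideanSpace ℝ (Fin 2)) s ×ˢ ball (0 : EuclideanSpace ℝ (Fin 2)) η)) ∧
      ContinuousOn Finv ((fun q : EuclideanSpace ℝ (Fin 2) × EuclideanSpace ℝ (Fin 2) => f q.1 + q.2 0 • m₀ q.1 + q.2 1 • m₁ q.1) ''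
        (ball (0 : EuclideanSpace ℝ (Fin 2)) s ×ˢ ball (0 : EuclideanSpace ℝ (Fin 2)) η)) ∧
      ∀ q ∈ ball (0 : EuclideanSpace ℝ (Fin 2)) s ×ˢ ball (0 : EuclideanSpace ℝ (Fin 2)) η,
        Finv (f q.1 + q.2 0 • m₀ q.1 + q.2 1 • m₁ q.1) = q := by
  set F : EuclideanSpace ℝ (Fin 2) × EuclideanSpace ℝ (Fin 2) → EuclideanSpace ℝ (Fin 4) :=
    fun q => f q.1 + q.2 0 • m₀ q.1 + q.2 1 • m₁ q.1 with hFdef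
  have hs0 : s ≠ 0 := hs.ne'
  -- the rescaled disc and frame
  set g : EuclideanSpace ℝ (Fin 2) → EuclideanSpace ℝ (Fin 4) := fun x => f (s • x) with hg
  set p₀ : EuclideanSpace ℝ (Fin 2) → EuclideanSpace ℝ (Fin 4) := fun x => m₀ (s • x) with hp₀
  set p₁ : EuclideanSpace ℝ (Fin 2) → EuclideanSpace ℝ (Fin 4) := fun x => m₁ (s • x) with hp₁
  have hsc : ContDiff ℝ ∞ fun x : EuclideanSpace ℝ (Fin 2) => s • x := contDiff_id.const_smul s
  have hgs : ContDiff ℝ ∞ g := hf.comp hsc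
  have hp₀s : ContDiff ℝ ∞ p₀ := hm₀.comp hsc
  have hp₁s : ContDiff ℝ ∞ p₁ := hm₁.comp hsc
  have hmemc : ∀ {r : ℝ} {x : EuclideanSpace ℝ (Fin 2)}, x ∈ closedBall (0 : EuclideanSpace ℝ (Fin 2)) r →
      s • x ∈ closedBall (0 : EuclideanSpace ℝ (Fin 2)) (s * r) := fun {r x} hx => by
    rw [mem_closedBall_zero_iff] at hx ⊢
    rw [norm_smul, Real.norm_of_nonneg hs.le]
    exact mul_le_mul_of_nonneg_left hx hs.le
  have hmemb : ∀ {r : ℝ} {x : EuclideanSpace ℝ (Fin 2)}, x ∈ ball (0 : EuclideanSpace ℝ (Fin 2)) r →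
      s • x ∈ ball (0 : EuclideanSpace ℝ (Fin 2)) (s * r) := fun {r x} hx => by
    rw [mem_ball_zero_iff] at hx ⊢
    rw [norm_smul, Real.norm_of_nonneg hs.le]
    exact mul_lt_mul_of_pos_left hx hs
  have hmemb' : ∀ {r : ℝ} {x : EuclideanSpace ℝ (Fin 2)}, x ∈ ball (0 : EuclideanSpace ℝ (Fin 2)) (s * r) →
      s⁻¹ • x ∈ ball (0 : EuclideanSpace ℝ (Fin 2)) r := fun {r x} hx => by
    rw [mem_ball_zero_iff] at hx ⊢
    rw [norm_smul, norm_inv, Real.norm_of_nonneg hs.le, inv_mul_lt_iff₀ hs]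
    exact hx
  have hmemc' : ∀ {r : ℝ} {x : EuclideanSpace ℝ (Fin 2)}, x ∈ closedBall (0 : EuclideanSpace ℝ (Fin 2)) (s * r) →
      s⁻¹ • x ∈ closedBall (0 : EuclideanSpace ℝ (Fin 2)) r := fun {r x} hx => by
    rw [mem_closedBall_zero_iff] at hx ⊢
    rw [norm_smul, norm_inv, Real.norm_of_nonneg hs.le, inv_mul_le_iff₀ hs]
    exact hx
  have hginj : InjOn g (closedBall (0 : EuclideanSpace ℝ (Fin 2)) 1) := fun x hx y hy hxy =>
    smul_right_injective _ hs0 (hinj (by simpa using hmemc hx) (by simpa using hmemc hy) hxy)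
  have hfd : ∀ x, HasFDerivAt g ((fderiv ℝ f (s • x)).comp (s • ContinuousLinearMap.id ℝ (EuclideanSpace ℝ (Fin 2)))) x :=
    fun x => ((hf.differentiable (by simp)) (s • x)).hasFDerivAt.comp x ((hasFDerivAt_id x).const_smul s)
  have hgtr : ∀ x ∈ closedBall (0 : EuclideanSpace ℝ (Fin 2)) 1, ∀ (e : EuclideanSpace ℝ (Fin 2)) (α β : ℝ),
      fderiv ℝ g x e + α • p₀ x + β • p₁ x = 0 → e = 0 ∧ α = 0 ∧ β = 0 := by
    intro x hx e α β h
    rw [(hfd x).fderiv, ContinuousLinearMap.comp_apply, _root_.smul_apply, ContinuousLinearMap.id_apply] at h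
    obtain ⟨he, hα, hβ⟩ := htr (s • x) (by simpa using hmemc hx) (s • e) α β h
    exact ⟨(smul_eq_zero.1 he).resolve_left hs0, hα, hβ⟩
  -- the unit-radius tube of the rescaled data
  obtain ⟨δ₁, η, Ginv, hδ₁, hη, -, -, -, -, hGinj, hGopen, hGinvs, hGleft⟩ :=
    exists_discTube_of_frame hgs hginj hp₀s hp₁s hgtr
  set G : EuclideanSpace ℝ (Fin 2) × EuclideanSpace ℝ (Fin 2) → EuclideanSpace ℝ (Fin 4) :=
    fun q => g q.1 + q.2 0 • p₀ q.1 + q.2 1 • p₁ q.1 with hGdef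
  have hGF : ∀ q, G q = F (s • q.1, q.2) := fun q => rfl
  have hFG : ∀ q, F q = G (s⁻¹ • q.1, q.2) := fun q => by
    rw [hGF]; simp only [smul_smul, mul_inv_cancel₀ hs0, one_smul]
  set dom : Set (EuclideanSpace ℝ (Fin 2) × EuclideanSpace ℝ (Fin 2)) :=
    ball (0 : EuclideanSpace ℝ (Fin 2)) (1 + δ₁) ×ˢ ball (0 : EuclideanSpace ℝ (Fin 2)) η with hdom
  set dom₁ : Set (EuclideanSpace ℝ (Fin 2) × EuclideanSpace ℝ (Fin 2)) :=
    ball (0 : EuclideanSpace ℝ (Fin 2)) 1 ×ˢ ball (0 : EuclideanSpace ℝ (Fin 2)) η with hdom₁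
  have hdom₁sub : dom₁ ⊆ dom := prod_mono (ball_subset_ball (by linarith)) Subset.rfl
  -- the image of the bidisc of radius `s` is the image of the unit bidisc of the rescaled tube
  have himg : F '' (ball (0 : EuclideanSpace ℝ (Fin 2)) s ×ˢ ball (0 : EuclideanSpace ℝ (Fin 2)) η) = G '' dom₁ := by
    ext y; constructor
    · rintro ⟨q, hq, rfl⟩
      refine ⟨(s⁻¹ • q.1, q.2), ⟨hmemb' (r := 1) (by rw [mul_one]; exact hq.1), hq.2⟩, (hFG q).symm⟩
    · rintro ⟨q, hq, rfl⟩
      exact ⟨(s • q.1, q.2), ⟨by simpa using hmemb hq.1, hq.2⟩, (hGF q).symm⟩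
  have himg' : G '' dom₁ = G '' dom ∩ Ginv ⁻¹' dom₁ := by
    ext y; constructor
    · rintro ⟨q, hq, rfl⟩
      exact ⟨⟨q, hdom₁sub hq, rfl⟩, by show Ginv (G q) ∈ dom₁; rw [hGleft q (hdom₁sub hq)]; exact hq⟩
    · rintro ⟨⟨q, hq, rfl⟩, hq'⟩
      have : Ginv (G q) = q := hGleft q hq
      rw [mem_preimage, this] at hq'
      exact ⟨q, hq', rfl⟩
  have hopen : IsOpen (G '' dom₁) := by
    rw [himg']; exact hGinvs.continuousOn.isOpen_inter_preimage hGopen (isOpen_ball.prod isOpen_ball)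
  refine ⟨η, fun y => (s • (Ginv y).1, (Ginv y).2), hη, ?_, ?_, ?_, ?_⟩
  · -- injectivity on the closed bidisc
    rintro q ⟨hq1, hq2⟩ q' ⟨hq1', hq2'⟩ hqq
    rw [hFG q, hFG q'] at hqq
    have h1 : ((s⁻¹ • q.1, q.2) : EuclideanSpace ℝ (Fin 2) × EuclideanSpace ℝ (Fin 2)) ∈
        closedBall (0 : EuclideanSpace ℝ (Fin 2)) (1 + δ₁) ×ˢ closedBall (0 : EuclideanSpace ℝ (Fin 2)) η :=
      ⟨closedBall_subset_closedBall (by linarith) (hmemc' (r := 1) (by rw [mul_one]; exact hq1)), hq2⟩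
    have h2 : ((s⁻¹ • q'.1, q'.2) : EuclideanSpace ℝ (Fin 2) × EuclideanSpace ℝ (Fin 2)) ∈
        closedBall (0 : EuclideanSpace ℝ (Fin 2)) (1 + δ₁) ×ˢ closedBall (0 : EuclideanSpace ℝ (Fin 2)) η :=
      ⟨closedBall_subset_closedBall (by linarith) (hmemc' (r := 1) (by rw [mul_one]; exact hq1')), hq2'⟩
    have := hGinj h1 h2 hqq
    simp only [Prod.mk.injEq] at this
    obtain ⟨h3, h4⟩ := this
    exact Prod.ext (smul_right_injective _ (inv_ne_zero hs0) h3) h4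
  · rw [himg]; exact hopen
  · rw [himg]
    have hc : ContinuousOn Ginv (G '' dom₁) := hGinvs.continuousOn.mono (image_mono hdom₁sub)
    exact ((continuous_fst.const_smul s).comp_continuousOn hc).prodMk (continuous_snd.comp_continuousOn hc)
  · rintro q hq
    have hq' : ((s⁻¹ • q.1, q.2) : EuclideanSpace ℝ (Fin 2) × EuclideanSpace ℝ (Fin 2)) ∈ dom :=
      hdom₁sub ⟨hmemb' (r := 1) (by rw [mul_one]; exact hq.1), hq.2⟩
    change (s • (Ginv (F q)).1, (Ginv (F q)).2) = q
    rw [hFG q, hGleft _ hq']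
    simp only [smul_smul, mul_inv_cancel₀ hs0, one_smul]

end FriendsCarrierVk

open FriendsCarrierVk in
/-- **Helper `helper_friendsCarrier_Vk_partA_partIII_tube`** (piece of `helper_friendsCarrier_Vk_partA_partIII`:
the affine tube of a disc of radius `s`, embedded on `B̄(0, s)`, on a transversal frame — injective on
`B̄(0, s) × B̄(0, η)`, open on the open bidisc, with a continuous inverse; see the module docstring).
[cite: Hirsch1976, Ch. 4 §5 Thm. 5.1] -/
theorem helper_friendsCarrier_Vk_partA_partIII_tube : ∀ (f m₀ m₁ : EuclideanSpace ℝ (Fin 2) → EuclideanSpace ℝ (Fin 4)) (s : ℝ), ContDiff ℝ ∞ f → ContDiff ℝ ∞ m₀ → ContDiff ℝ ∞ m₁ → 0 < s → InjOn f (closedBall (0 : EuclideanSpace ℝ (Fin 2)) s) → (∀ x ∈ closedBall (0 : EuclideanSpace ℝ (Fin 2)) s, ∀ (e : EuclideanSpace ℝ (Fin 2)) (α β : ℝ), fderiv ℝ f x e + α • m₀ x + β • m₁ x = 0 → e = 0 ∧ α = 0 ∧ β = 0) → ∃ (η : ℝ) (Finv : EuclideanSpace ℝ (Fin 4) → EuclideanSpace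 ℝ (Fin 2) × EuclideanSpace ℝ (Fin 2)), 0 < η ∧ InjOn (fun q : EuclideanSpace ℝ (Fin 2) × EuclideanSpace ℝ (Fin 2) => f q.1 + q.2 0 • m₀ q.1 + q.2 1 • m₁ q.1) (closedBall (0 : EuclideanSpace ℝ (Fin 2)) s ×ˢ closedBall (0 : EuclideanSpace ℝ (Fin 2)) η) ∧ IsOpen ((fun q : EuclideanSpace ℝ (Fin 2) × EuclideanSpace ℝ (Fin 2) => f q.1 + q.2 0 • m₀ q.1 + q.2 1 • m₁ q.1) '' (ball (0 : EuclideanSpace ℝ (Fin 2)) s ×ˢ ball (0 : EuclideanSpace ℝ (Fin 2)) η)) ∧ ContinuousOn Finv ((fun q : EuclideanSpace ℝ (Fin 2) × EuclideanSpace ℝ (Fin 2) => f q.1 + q.2 0 • m₀ q.1 + q.2 1 • m₁ q.1) '' (ball (0 : EuclideanSpace ℝ (Fin 2)) s ×ˢ ball (0 : EuclideanSpace ℝ (Fin 2)) η)) ∧ ∀ q ∈ ball (0 : EuclideanSpace ℝ (Fin 2)) s ×ˢ ball (0 : EuclideanSpace ℝ (Fin 2)) η, Finv (f q.1 + q.2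 0 • m₀ q.1 + q.2 1 • m₁ q.1) = q :=
  fun _ _ _ _ hf hm₀ hm₁ hs hinj htr => exists_tube_of_radius hf hm₀ hm₁ hs hinj htr

end Summit.SmoothPoincare4.SmoothPoincare4.Theorems.DcrGap.MkFriends

end
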